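import Summits.CriticalPhenomena.PercolationContinuityZ3.Theorems.PercNearOneGluingNoHeavyLowerTailSahiThreeCopyCellPlacement
import Summits.CriticalPhenomena.PercolationContinuityZ3.Theorems.PercNearOneGluingNoHeavyLowerTailSahiThreeCopyCellC8All

/-!
# `NoHeavyLowerTail` (crux stmt-CriticalPhenomena-4575), Sahi programme: `C₆` and `C₈` on ARBITRARY coordinates

Support file (Sahi cell, seat `prim-sahi-p1`, generation 65; `--supports stmt-CriticalPhenomena-4575`).  Corollaries of `lawGood_C6_all` / `lawGood_C8_all` and
`sahiE_three_coin_relab_nonneg_of_lawGood`: Sahi's `E₃ ≥ 0` for `(1_{C} ∘ relabelling, G, H)` where the read-once slot `C = ⋀(x_a ∨ x_b)` (three or four disjoint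
pairs) sits on ANY coordinates of the cube `{0,1}^n` (`n ≥ 6`, resp. `n ≥ 8`), under every product measure, for all monotone `[0,1]`-valued `G, H`.
COMPUTATIONAL content inherited from the cell certificates. [this work]
-/

namespace Summit.CriticalPhenomena.PercolationContinuityZ3.Theorems.SahiThreeCopy

open Finset Function Literature.Combinatorics.Sahi2008
open scoped BigOperators

/-- ★★★★ `E₃^{coin Q}(1_{C₈} ∘ front ∘ relab σ, G, H) ≥ 0` for EVERY coordinate permutation `σ` of `{0,1}^{d+8}` (the four OR-pairs on any eight
coordinates, in any pairing), every `Q ∈ [0,1]^{d+8}`, all monotone `[0,1]`-valued `G, H`. [this work] -/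
theorem sahiE3_C8_relab_coin_nonneg {d : ℕ} (σ : Equiv.Perm (Fin (d + 8))) {Q : Fin (d + 8) → ℝ} (hQ : ∀ i, 0 ≤ Q i ∧ Q i ≤ 1)
    {G H : Pt (d + 8) → ℝ} (hG : ∀ w, 0 ≤ G w) (hG1 : ∀ w, G w ≤ 1) (hH : ∀ w, 0 ≤ H w) (hH1 : ∀ w, H w ≤ 1) (hGm : Monotone G) (hHm : Monotone H) :
    0 ≤ sahiE (coinWeight Q) 3 ![frontFn 8 (setInd C8set) ∘ relab σ, G, H] :=
  sahiE_three_coin_relab_nonneg_of_lawGood lawGood_C8_all σ hQ hG hG1 hH hH1 hGm hHm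

/-- ★★★ The same for `C₆` (three OR-pairs on any six coordinates of `{0,1}^{d+6}`). [this work] -/
theorem sahiE3_C6_relab_coin_nonneg {d : ℕ} (σ : Equiv.Perm (Fin (d + 6))) {Q : Fin (d + 6) → ℝ} (hQ : ∀ i, 0 ≤ Q i ∧ Q i ≤ 1)
    {G H : Pt (d + 6) → ℝ} (hG : ∀ w, 0 ≤ G w) (hG1 : ∀ w, G w ≤ 1) (hH : ∀ w, 0 ≤ H w) (hH1 : ∀ w, H w ≤ 1) (hGm : Monotone G) (hHm : Monotone H) :
    0 ≤ sahiE (coinWeight Q) 3 ![frontFn 6 (setInd C6set) ∘ relab σ, G, H] :=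
  sahiE_three_coin_relab_nonneg_of_lawGood lawGood_C6_all σ hQ hG hG1 hH hH1 hGm hHm

end Summit.CriticalPhenomena.PercolationContinuityZ3.Theorems.SahiThreeCopy
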